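import Literature.MathematicalPhysics.KineticTheory.LangevinChainSDE
import HarnessLib

/-!
# Additive-noise SDEs, pathwise: the global flow of `z(t) = x + n(t) + ∫₀ᵗ Y(z)` for a confined drift

Trunk T-KINETIC (Literature/MathematicalPhysics/KineticTheory); deterministic layer of the
construction of transition semigroups of SDEs with ADDITIVE noise (Langevin-type models:
Cuneo–Eckmann–Hairer–Rey-Bellet 2018 eq. (2.2); Rey-Bellet–Thomas 2002 (RBT-SDE)). For such an
SDE `dz = Y(z) dt + ∑_b v_b dB_b` every continuous noise path `n(t) = ∑_b B_b(t) v_b` turns the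
equation into the integral equation

  `z(t) = x + n(t) + ∫₀ᵗ Y(z(s)) ds`,                                                     (IE)

solved path by path. `LangevinChainSDE.lean` did this for ONE model (the pinned chain, whose energy
bounds are quartic-specific). This file is the MODEL-FREE version: the only model input is a
hypothesis structure `ConfinedDrift Y` — a `C¹` drift `Y` on a finite-dimensional space together
with a differentiable "energy" `V ≥ -c` whose sublevel sets are bounded (radius function `ρ`) and
which grows at most linearly along the driven dynamics,
`DV(y)·Y(y + e) ≤ K(M) (V(y) + c)` for `‖e‖ ≤ M` in the noise subspace
(for a Hamiltonian system with friction and additive forcing this is the energy balance: the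
Hamiltonian part conserves `V`, friction dissipates, and the forcing injects at a rate linear in
`‖e‖`; RBT Lemma 3.5 / CEHR (3.4) are its stochastic counterparts). From it, exactly as in
`LangevinChainSDE.lean` (same proofs):

* `ConfinedDrift.energy_truncSol_le` — the a-priori bound `V(z(t) - n(t)) + c ≤ (V(x) + c) e^{K M t}`
  for the Picard solution `z` of (IE) with the drift truncated at any radius (Grönwall for
  `t ↦ V(y(t))`, `y = z - n`, `y' = Y_R(z)`);
* `ConfinedDrift.apriori` — a radius `R₀(V(x), M, T)` containing every truncated solution on
  `[0, T]`, so beyond it the truncation is invisible and all truncated solutions agree;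
* `drivenFlow Y x n t` — THE solution of (IE): continuous in `t`, solves (IE) on every `[0, T]`
  (`isIntegralSolutionOn_flow`), unique (`eqOn_flow`), local in the noise (`flow_congr`), with the
  cocycle identity `z_{x,n}(s+t) = z_{z_{x,n}(s), n(s+·)-n(s)}(t)` (`flow_add`, the pathwise Markov
  property), continuous in `x` (`continuous_flow_left`) and jointly measurable in measurably
  parametrised data (`measurable_flow`).

## References

* R. Khasminskii, *Stochastic Stability of Differential Equations* (2nd ed., 2012), Thm 3.5
  (non-explosion from a Lyapunov function), §3.4.
* L. Rey-Bellet, L. E. Thomas, Comm. Math. Phys. **225** (2002) 305–329, §2 eq. (12) and Lemma 3.5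
  ("the Markov process `x(t)` is non-explosive").
* E. A. Coddington, N. Levinson, *Theory of Ordinary Differential Equations* (1955), Ch. 1.
-/

noncomputable section

open MeasureTheory Filter Topology Set Metric
open scoped NNReal ContDiff

namespace Literature.MathematicalPhysics.KineticTheory

open Literature.Analysis.ODE

variable {E : Type*} [NormedAddCommGroup E] [NormedSpace ℝ E]

/-! ### The hypothesis structure -/

/-- **A confined drift**: a `C¹` vector field `Y` on `E` with an energy function `V` such that
`V + c ≥ 0`, the sublevel sets `{V ≤ B}` lie in the balls `closedBall 0 (ρ B)` (`ρ` monotone), and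
along the dynamics driven by a bounded perturbation FROM THE NOISE SUBSPACE `noise` (where the
additive forcing lives: the momentum directions of the bath sites for a Langevin chain, the
auxiliary reservoir variables for RBT-SDE) the energy grows at most linearly:
`DV(y)·Y(y + e) ≤ K(M) (V(y) + c)` whenever `e ∈ noise`, `‖e‖ ≤ M` (`K(M) ≥ 0`). This is the deterministic
non-explosion mechanism of Langevin-type SDEs with additive noise (Khasminskii Thm 3.5 made
pathwise). [folklore] -/
structure ConfinedDrift (Y : E → E) where
  /-- the energy (Lyapunov) function -/
  V : E → ℝ
  /-- a constant with `V + c ≥ 0` -/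
  c : ℝ
  /-- the growth rate of the energy under a perturbation of size `≤ M` -/
  K : ℝ → ℝ
  /-- radius of a ball containing the sublevel set `{V ≤ B}` -/
  ρ : ℝ → ℝ
  /-- the subspace in which the noise (the additive forcing) takes its values -/
  noise : Submodule ℝ E
  contDiff_drift : ContDiff ℝ 1 Y
  differentiable_energy : Differentiable ℝ V
  energy_nonneg : ∀ y, 0 ≤ V y + c
  rate_nonneg : ∀ M, 0 ≤ M → 0 ≤ K M
  fderiv_energy_le : ∀ (M : ℝ) (y e : E), e ∈ noise → ‖e‖ ≤ M →
    fderiv ℝ V y (Y (y + e)) ≤ K M * (V y + c)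
  norm_le_radius : ∀ (y : E) (B : ℝ), V y ≤ B → ‖y‖ ≤ ρ B
  radius_mono : Monotone ρ

/-! ### Truncated solutions and the flow (definitions) -/

section Defs

variable [CompleteSpace E]

/-- The Picard solution of (IE) with the drift truncated at radius `R` (`Y_R = χ_R • Y`, globally
Lipschitz for a `C¹` drift on a finite-dimensional space). [folklore] -/
def drivenTruncSol (Y : E → E) (R : ℝ) (x : E) (n : ℝ → E) : ℝ → E :=
  forcedSolution (truncateField R Y) fun t => x + n t

/-- **The pathwise solution of `z(t) = x + n(t) + ∫₀ᵗ Y(z)`**: the limit of the truncated Picard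
solutions along the radii `k + 1 → ∞` (eventually constant for a confined drift,
`ConfinedDrift.flow_eqOn_truncSol`); clamped to `x + n(0)` on `(-∞, 0]`. [folklore] -/
def drivenFlow (Y : E → E) (x : E) (n : ℝ → E) (t : ℝ) : E :=
  limUnder atTop fun k : ℕ => drivenTruncSol Y (k + 1) x n t

end Defs

omit [NormedSpace ℝ E] in
/-- A bound for a continuous path on `[0, T]` exists. [folklore] -/
theorem exists_forcingBound {n : ℝ → E} (hn : Continuous n) (T : ℝ) :
    ∃ M, 0 ≤ M ∧ ∀ t ∈ Icc 0 T, ‖n t‖ ≤ M := by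
  obtain ⟨M, hM⟩ := isCompact_Icc.exists_bound_of_continuousOn (hn.continuousOn (s := Icc 0 T))
  exact ⟨max M 0, le_max_right _ _, fun t ht => (hM t ht).trans (le_max_left _ _)⟩

namespace ConfinedDrift

variable [FiniteDimensional ℝ E] [CompleteSpace E] {Y : E → E} (D : ConfinedDrift Y)
include D

omit [CompleteSpace E] in
/-- The truncated drift is globally Lipschitz (some constant). [folklore] -/
theorem exists_lipschitzWith_trunc {R : ℝ} (hR : 0 < R) :
    ∃ L : ℝ≥0, LipschitzWith L (truncateField R Y) :=
  exists_lipschitzWith_truncateField D.contDiff_drift hR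

omit [FiniteDimensional ℝ E] [CompleteSpace E] in
/-- The energy is continuous. [folklore] -/
theorem continuous_energy : Continuous D.V := D.differentiable_energy.continuous

/-! ### The a-priori energy bound -/

/-- **The a-priori energy bound** (non-explosion estimate) for the truncated dynamics, uniform in
the truncation radius `R > 0`: if `‖n‖ ≤ M` on `[0, T]` then `z = drivenTruncSol Y R x n` satisfies
`V(z(t) - n(t)) + c ≤ (V(x) + c) e^{K(M) t}` on `[0, T]` (Grönwall for `h(t) = V(y(t)) + c`,
`y = z - n = x + ∫₀ᵗ Y_R(z)`, `h' = χ_R(z) DV(y)·Y(y + n) ≤ K(M) h`). [folklore] -/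
theorem energy_truncSol_le {R : ℝ} (hR : 0 < R) (x : E) {n : ℝ → E} (hn : Continuous n)
    (hnS : ∀ t, n t ∈ D.noise) {T M : ℝ} (hM : ∀ t ∈ Icc 0 T, ‖n t‖ ≤ M) :
    ∀ t ∈ Icc 0 T, D.V (drivenTruncSol Y R x n t - n t) + D.c ≤
      (D.V x + D.c) * Real.exp (D.K M * t) := by
  intro t ht
  set YR := truncateField R Y with hYRdef
  set g : ℝ → E := fun t => x + n t with hgdef
  set z := drivenTruncSol Y R x n with hzdef
  have hT : 0 ≤ T := ht.1.trans ht.2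
  have hM0 : 0 ≤ M := (norm_nonneg _).trans (hM 0 ⟨le_rfl, hT⟩)
  have hK0 : 0 ≤ D.K M := D.rate_nonneg M hM0
  obtain ⟨L, hL⟩ := D.exists_lipschitzWith_trunc hR
  have hYc : Continuous Y := D.contDiff_drift.continuous
  have hYRc : Continuous YR := continuous_truncateField R hYc
  have hg : Continuous g := continuous_const.add hn
  have hz_eq : ∀ s, 0 ≤ s → z s = g s + ∫ r in (0 : ℝ)..s, YR (z r) := fun s hs =>
    forcedSolution_eq hL hg hs
  have hzc : Continuous z := continuous_forcedSolution hL hg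
  have hVd := D.differentiable_energy
  -- `y(t) = x + ∫₀ᵗ Y_R(z)`, `y' = Y_R(z)`, `y = z - n` on `[0, ∞)`
  set y : ℝ → E := fun s => x + ∫ r in (0 : ℝ)..s, YR (z r) with hydef
  have hy_deriv : ∀ s, HasDerivAt y (YR (z s)) s := fun s => by
    have h1 : HasDerivAt (fun u => ∫ r in (0 : ℝ)..u, YR (z r)) (YR (z s)) s :=
      ((hYRc.comp hzc).integral_hasStrictDerivAt 0 s).hasDerivAt
    exact h1.const_add x
  have hy_eq : ∀ s, 0 ≤ s → y s = z s - n s := fun s hs => by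
    rw [hz_eq s hs]
    simp only [hydef, hgdef]
    abel
  have hz_y : ∀ s, 0 ≤ s → z s = y s + n s := fun s hs => by
    rw [hy_eq s hs, sub_add_cancel]
  -- the energy along `y`
  set h : ℝ → ℝ := fun s => D.V (y s) + D.c with hhdef
  have hh_deriv : ∀ s, HasDerivAt h (fderiv ℝ D.V (y s) (YR (z s))) s := fun s =>
    ((hVd (y s)).hasFDerivAt.comp_hasDerivAt s (hy_deriv s)).add_const D.c
  have hh_cont : Continuous h := continuous_iff_continuousAt.2 fun s => (hh_deriv s).continuousAt
  have hh0 : ∀ s, 0 ≤ h s := fun s => D.energy_nonneg (y s)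
  have hbound : ∀ s ∈ Ico 0 T, fderiv ℝ D.V (y s) (YR (z s)) ≤ D.K M * h s + 0 := by
    intro s hs
    have hB : fderiv ℝ D.V (y s) (Y (z s)) ≤ D.K M * h s := by
      rw [hz_y s hs.1]
      exact D.fderiv_energy_le M (y s) (n s) (hnS s) (hM s ⟨hs.1, hs.2.le⟩)
    have hc0 := radialCutoff_nonneg R (z s)
    have hc1 := radialCutoff_le_one R (z s)
    have hpos : 0 ≤ D.K M * h s := mul_nonneg hK0 (hh0 s)
    calc fderiv ℝ D.V (y s) (YR (z s)) = radialCutoff R (z s) * fderiv ℝ D.V (y s) (Y (z s)) := by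
          rw [hYRdef, truncateField, map_smul, smul_eq_mul]
      _ ≤ radialCutoff R (z s) * (D.K M * h s) := mul_le_mul_of_nonneg_left hB hc0
      _ ≤ 1 * (D.K M * h s) := mul_le_mul_of_nonneg_right hc1 hpos
      _ = D.K M * h s + 0 := by ring
  -- Grönwall
  have hG := le_gronwallBound_of_liminf_deriv_right_le (f := h)
    (f' := fun s => fderiv ℝ D.V (y s) (YR (z s))) (δ := D.V x + D.c) (K := D.K M) (ε := 0) (a := 0)
    (b := T) hh_cont.continuousOn (fun s _ r hr => ?_) (by simp [hhdef, hydef]) hbound t ht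
  · rw [sub_zero, gronwallBound_ε0] at hG
    have hfin : h t = D.V (z t - n t) + D.c := by
      show D.V (y t) + D.c = _
      rw [hy_eq t ht.1]
    rwa [hfin] at hG
  · have := ((hh_deriv s).hasDerivWithinAt (s := Ici s)).liminf_right_slope_le hr
    refine this.mono fun w hw => ?_
    rwa [slope_def_field, div_eq_inv_mul] at hw

/-- **The a-priori radius** `R₀(E₀, M, T) = ρ((E₀ + c) e^{K(M) T} - c) + M`: every truncated
solution started at energy `V(x) ≤ E₀` and driven by a path with `‖n‖ ≤ M` on `[0, T]` stays in the
closed ball of radius `R₀` on `[0, T]` (`norm_truncSol_le`). [folklore] -/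
def apriori (E₀ M T : ℝ) : ℝ :=
  D.ρ ((E₀ + D.c) * Real.exp (D.K M * T) - D.c) + M

omit [FiniteDimensional ℝ E] [CompleteSpace E] in
/-- The a-priori radius is monotone in the initial energy level. [folklore] -/
theorem apriori_mono {E₀ E₀' : ℝ} (M T : ℝ) (h : E₀ ≤ E₀') : D.apriori E₀ M T ≤ D.apriori E₀' M T := by
  unfold apriori
  refine add_le_add (D.radius_mono ?_) le_rfl
  have := Real.exp_pos (D.K M * T)
  nlinarith

/-- **Truncated solutions stay in the a-priori ball**: `‖drivenTruncSol Y R x n t‖ ≤ R₀(V(x), M, T)`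
on `[0, T]`, for every truncation radius `R > 0`. [folklore] -/
theorem norm_truncSol_le {R : ℝ} (hR : 0 < R) (x : E) {n : ℝ → E} (hn : Continuous n)
    (hnS : ∀ t, n t ∈ D.noise) {T M : ℝ} (hM : ∀ t ∈ Icc 0 T, ‖n t‖ ≤ M) :
    ∀ t ∈ Icc 0 T, ‖drivenTruncSol Y R x n t‖ ≤ D.apriori (D.V x) M T := by
  intro t ht
  set z := drivenTruncSol Y R x n t
  have hT : 0 ≤ T := ht.1.trans ht.2
  have hM0 : 0 ≤ M := (norm_nonneg _).trans (hM 0 ⟨le_rfl, hT⟩)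
  have hK0 : 0 ≤ D.K M := D.rate_nonneg M hM0
  have hE := D.energy_truncSol_le hR x hn hnS hM t ht
  have hexp : Real.exp (D.K M * t) ≤ Real.exp (D.K M * T) :=
    Real.exp_le_exp.2 (mul_le_mul_of_nonneg_left ht.2 hK0)
  have hVx : 0 ≤ D.V x + D.c := D.energy_nonneg x
  have hy : ‖z - n t‖ ≤ D.ρ ((D.V x + D.c) * Real.exp (D.K M * T) - D.c) := by
    refine D.norm_le_radius _ _ ?_
    nlinarith [mul_le_mul_of_nonneg_left hexp hVx]
  calc ‖z‖ = ‖(z - n t) + n t‖ := by rw [sub_add_cancel]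
    _ ≤ ‖z - n t‖ + ‖n t‖ := norm_add_le _ _
    _ ≤ _ := add_le_add hy (hM t ht)

/-- **Beyond the a-priori radius the truncation is invisible**: if `R₀(V(x), M, T) ≤ R` then
`drivenTruncSol Y R x n` solves the UNtruncated equation (IE) on `[0, T]`. [folklore] -/
theorem isIntegralSolutionOn_truncSol {R : ℝ} (hR : 0 < R) (x : E) {n : ℝ → E} (hn : Continuous n)
    (hnS : ∀ t, n t ∈ D.noise) {T M : ℝ} (hM : ∀ t ∈ Icc 0 T, ‖n t‖ ≤ M)
    (hRR : D.apriori (D.V x) M T ≤ R) :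
    IsIntegralSolutionOn Y (fun t => x + n t) (drivenTruncSol Y R x n) T := by
  intro t ht
  obtain ⟨L, hL⟩ := D.exists_lipschitzWith_trunc hR
  have h := forcedSolution_eq hL (continuous_const.add hn) ht.1 (g := fun t => x + n t)
  unfold drivenTruncSol
  rw [h]
  congr 1
  refine intervalIntegral.integral_congr fun s hs => ?_
  rw [uIcc_of_le ht.1] at hs
  exact truncateField_of_norm_le hR _
    ((D.norm_truncSol_le hR x hn hnS hM s ⟨hs.1, hs.2.trans ht.2⟩).trans hRR)

omit [CompleteSpace E] in
/-- **Uniqueness for the untruncated equation**: two continuous solutions of (IE) with the same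
forcing coincide on `[0, T]` (both are bounded there and the `C¹` drift is Lipschitz on bounded
sets). [folklore] -/
theorem eqOn_of_isIntegralSolutionOn {g z₁ z₂ : ℝ → E} {T : ℝ} (h₁ : IsIntegralSolutionOn Y g z₁ T)
    (h₂ : IsIntegralSolutionOn Y g z₂ T) (hc₁ : Continuous z₁) (hc₂ : Continuous z₂) :
    EqOn z₁ z₂ (Icc 0 T) := by
  obtain ⟨B₁, hB₁⟩ := isCompact_Icc.exists_bound_of_continuousOn (hc₁.continuousOn (s := Icc 0 T))
  obtain ⟨B₂, hB₂⟩ := isCompact_Icc.exists_bound_of_continuousOn (hc₂.continuousOn (s := Icc 0 T))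
  obtain ⟨L, hL⟩ := exists_lipschitzOnWith_closedBall D.contDiff_drift (max B₁ B₂)
  refine h₁.eqOn_of_lipschitzOnWith hL h₂ hc₁ hc₂ (fun t ht => ?_) fun t ht => ?_
  · rw [mem_closedBall, dist_zero_right]; exact (hB₁ t ht).trans (le_max_left _ _)
  · rw [mem_closedBall, dist_zero_right]; exact (hB₂ t ht).trans (le_max_right _ _)

/-- Truncated solutions with radii beyond the a-priori radius agree on `[0, T]`. [folklore] -/
theorem truncSol_eqOn {R R' : ℝ} (hR : 0 < R) (hR' : 0 < R') (x : E) {n : ℝ → E}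
    (hn : Continuous n) (hnS : ∀ t, n t ∈ D.noise) {T M : ℝ} (hM : ∀ t ∈ Icc 0 T, ‖n t‖ ≤ M)
    (hRR : D.apriori (D.V x) M T ≤ R) (hRR' : D.apriori (D.V x) M T ≤ R') :
    EqOn (drivenTruncSol Y R x n) (drivenTruncSol Y R' x n) (Icc 0 T) := by
  obtain ⟨L, hL⟩ := D.exists_lipschitzWith_trunc hR
  obtain ⟨L', hL'⟩ := D.exists_lipschitzWith_trunc hR'
  exact D.eqOn_of_isIntegralSolutionOn (D.isIntegralSolutionOn_truncSol hR x hn hnS hM hRR)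
    (D.isIntegralSolutionOn_truncSol hR' x hn hnS hM hRR')
    (continuous_forcedSolution hL (continuous_const.add hn))
    (continuous_forcedSolution hL' (continuous_const.add hn))

/-! ### The flow -/

/-- **The flow is the truncated solution for every radius beyond the a-priori radius** (the
defining limit is eventually constant). [folklore] -/
theorem flow_eqOn_truncSol {R : ℝ} (hR : 0 < R) (x : E) {n : ℝ → E} (hn : Continuous n)
    (hnS : ∀ t, n t ∈ D.noise) {T M : ℝ} (hM : ∀ t ∈ Icc 0 T, ‖n t‖ ≤ M)
    (hRR : D.apriori (D.V x) M T ≤ R) :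
    EqOn (drivenFlow Y x n) (drivenTruncSol Y R x n) (Icc 0 T) := by
  intro t ht
  unfold drivenFlow
  refine Filter.Tendsto.limUnder_eq (tendsto_const_nhds.congr' ?_)
  obtain ⟨k₀, hk₀⟩ := exists_nat_ge R
  filter_upwards [eventually_ge_atTop k₀] with k hk
  have hkR : R ≤ (k : ℝ) + 1 := hk₀.trans (by exact_mod_cast Nat.le_succ_of_le hk)
  exact D.truncSol_eqOn hR (by positivity) x hn hnS hM hRR (hRR.trans hkR) ht

/-- For `t ≤ 0` the flow is clamped at its initial value `x + n 0`. [folklore] -/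
theorem flow_of_nonpos (x : E) {n : ℝ → E} (hn : Continuous n) {t : ℝ} (ht : t ≤ 0) :
    drivenFlow Y x n t = x + n 0 := by
  unfold drivenFlow
  refine Filter.Tendsto.limUnder_eq (tendsto_const_nhds.congr' (Eventually.of_forall fun k => ?_))
  obtain ⟨L, hL⟩ := D.exists_lipschitzWith_trunc (by positivity : (0 : ℝ) < k + 1)
  have hg : Continuous fun t => x + n t := continuous_const.add hn
  show x + n 0 = drivenTruncSol Y (k + 1) x n t
  unfold drivenTruncSol
  rw [forcedSolution_of_nonpos _ _ ht, forcedSolution_zero hL hg]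

/-- **The flow solves the integral equation (IE)** on every `[0, T]`. [folklore] -/
theorem isIntegralSolutionOn_flow (x : E) {n : ℝ → E} (hn : Continuous n)
    (hnS : ∀ t, n t ∈ D.noise) (T : ℝ) :
    IsIntegralSolutionOn Y (fun t => x + n t) (drivenFlow Y x n) T := by
  obtain ⟨M, -, hM⟩ := exists_forcingBound hn T
  set R := max (D.apriori (D.V x) M T) 1
  have hR : 0 < R := lt_max_of_lt_right one_pos
  exact (D.isIntegralSolutionOn_truncSol hR x hn hnS hM (le_max_left _ _)).congr
    (D.flow_eqOn_truncSol hR x hn hnS hM (le_max_left _ _)).symm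

/-- **The flow is continuous in time** (on all of `ℝ`, being clamped on `(-∞, 0]`). [folklore] -/
theorem continuous_flow (x : E) {n : ℝ → E} (hn : Continuous n) (hnS : ∀ t, n t ∈ D.noise) :
    Continuous (drivenFlow Y x n) := by
  refine continuous_of_continuousOn_Icc_of_eq_max (fun T => ?_) fun t => ?_
  · obtain ⟨M, -, hM⟩ := exists_forcingBound hn T
    set R := max (D.apriori (D.V x) M T) 1
    have hR : 0 < R := lt_max_of_lt_right one_pos
    obtain ⟨L, hL⟩ := D.exists_lipschitzWith_trunc hR
    exact ((continuous_forcedSolution hL (continuous_const.add hn)).continuousOn).congr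
      (D.flow_eqOn_truncSol hR x hn hnS hM (le_max_left _ _))
  · rcases le_total t 0 with ht | ht
    · rw [max_eq_right ht, D.flow_of_nonpos x hn ht, D.flow_of_nonpos x hn le_rfl]
    · rw [max_eq_left ht]

/-- **The flow stays in the a-priori ball**: `‖drivenFlow Y x n t‖ ≤ R₀(V(x), M, T)` on `[0, T]`
if `‖n‖ ≤ M` there. [folklore] -/
theorem norm_flow_le (x : E) {n : ℝ → E} (hn : Continuous n) (hnS : ∀ t, n t ∈ D.noise) {T M : ℝ}
    (hM : ∀ t ∈ Icc 0 T, ‖n t‖ ≤ M) :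
    ∀ t ∈ Icc 0 T, ‖drivenFlow Y x n t‖ ≤ D.apriori (D.V x) M T := by
  intro t ht
  set R := max (D.apriori (D.V x) M T) 1
  have hR : 0 < R := lt_max_of_lt_right one_pos
  rw [D.flow_eqOn_truncSol hR x hn hnS hM (le_max_left _ _) ht]
  exact D.norm_truncSol_le hR x hn hnS hM t ht

/-- The energy along the flow: `V(z(t) - n(t)) + c ≤ (V(x) + c) e^{K(M) t}` on `[0, T]`.
[folklore] -/
theorem energy_flow_le (x : E) {n : ℝ → E} (hn : Continuous n) (hnS : ∀ t, n t ∈ D.noise)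
    {T M : ℝ} (hM : ∀ t ∈ Icc 0 T, ‖n t‖ ≤ M) :
    ∀ t ∈ Icc 0 T, D.V (drivenFlow Y x n t - n t) + D.c ≤ (D.V x + D.c) * Real.exp (D.K M * t) := by
  intro t ht
  set R := max (D.apriori (D.V x) M T) 1
  have hR : 0 < R := lt_max_of_lt_right one_pos
  rw [D.flow_eqOn_truncSol hR x hn hnS hM (le_max_left _ _) ht]
  exact D.energy_truncSol_le hR x hn hnS hM t ht

/-- **Uniqueness**: any continuous solution of (IE) is the flow on `[0, T]`. [folklore] -/
theorem eqOn_flow (x : E) {n : ℝ → E} (hn : Continuous n) (hnS : ∀ t, n t ∈ D.noise)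
    {z : ℝ → E} {T : ℝ} (hz : IsIntegralSolutionOn Y (fun t => x + n t) z T) (hzc : Continuous z) :
    EqOn z (drivenFlow Y x n) (Icc 0 T) :=
  D.eqOn_of_isIntegralSolutionOn hz (D.isIntegralSolutionOn_flow x hn hnS T) hzc
    (D.continuous_flow x hn hnS)

/-- The flow on `[0, T]` only depends on the noise path on `[0, T]`. [folklore] -/
theorem flow_congr (x : E) {n₁ n₂ : ℝ → E} (hn₁ : Continuous n₁) (hn₂ : Continuous n₂)
    (hn₁S : ∀ t, n₁ t ∈ D.noise) (hn₂S : ∀ t, n₂ t ∈ D.noise) {T : ℝ}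
    (h : EqOn n₁ n₂ (Icc 0 T)) : EqOn (drivenFlow Y x n₁) (drivenFlow Y x n₂) (Icc 0 T) := by
  refine D.eqOn_flow x hn₂ hn₂S ?_ (D.continuous_flow x hn₁ hn₁S)
  exact (D.isIntegralSolutionOn_flow x hn₁ hn₁S T).congr_forcing fun t ht => by simp [h ht]

/-- **The cocycle (flow) property**: for `s, t ≥ 0`, `z_{x,n}(s + t) = z_{x',n'}(t)` with
`x' = z_{x,n}(s)` and the shifted noise `n' = n(s + ·) - n(s)` — the pathwise identity behind the
Markov property of the transition semigroup. [folklore] -/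
theorem flow_add (x : E) {n : ℝ → E} (hn : Continuous n) (hnS : ∀ t, n t ∈ D.noise) {s t : ℝ}
    (hs : 0 ≤ s) (ht : 0 ≤ t) :
    drivenFlow Y x n (s + t) = drivenFlow Y (drivenFlow Y x n s) (fun r => n (s + r) - n s) t := by
  have hzc := D.continuous_flow x hn hnS
  have hn' : Continuous fun r => n (s + r) - n s := (hn.comp (continuous_const_add s)).sub continuous_const
  have hn'S : ∀ r, n (s + r) - n s ∈ D.noise := fun r => D.noise.sub_mem (hnS _) (hnS _)
  have hsol : IsIntegralSolutionOn Y (fun r => drivenFlow Y x n s + (n (s + r) - n s))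
      (fun r => drivenFlow Y x n (s + r)) (s + t - s) := by
    have h1 := (D.isIntegralSolutionOn_flow x hn hnS (s + t)).shift
      ((D.contDiff_drift.continuous.comp hzc).continuousOn) ⟨hs, le_add_of_nonneg_right ht⟩
    refine h1.congr_forcing fun r _ => ?_
    simp only
    abel
  rw [add_sub_cancel_left] at hsol
  exact D.eqOn_flow _ hn' hn'S hsol (hzc.comp (continuous_const_add s)) ⟨ht, le_rfl⟩

omit [CompleteSpace E] in
/-- The energy is bounded on bounded sets: a bound of `V` on the closed ball `closedBall x₀ 1`.
[folklore] -/
theorem exists_bound_energy_closedBall (x₀ : E) : ∃ E₁, ∀ x ∈ closedBall x₀ 1, D.V x ≤ E₁ := by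
  obtain ⟨E₁, hE₁⟩ := (isCompact_closedBall x₀ 1).exists_bound_of_continuousOn
    (D.continuous_energy.continuousOn)
  exact ⟨E₁, fun x hx => (Real.le_norm_self _).trans (hE₁ x hx)⟩

/-- **Continuous dependence on the initial condition**: `x ↦ z_{x,n}(t)` is continuous (locally
Lipschitz, by Grönwall for the common truncated equation). [folklore] -/
theorem continuous_flow_left {n : ℝ → E} (hn : Continuous n) (hnS : ∀ t, n t ∈ D.noise) (t : ℝ) :
    Continuous fun x => drivenFlow Y x n t := by
  rcases le_or_gt t 0 with ht | ht
  · have : (fun x => drivenFlow Y x n t) = fun x => x + n 0 :=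
      funext fun x => D.flow_of_nonpos x hn ht
    rw [this]
    exact continuous_id.add continuous_const
  refine continuous_iff_continuousAt.2 fun x₀ => ?_
  obtain ⟨M, -, hM⟩ := exists_forcingBound hn t
  obtain ⟨E₁, hE₁⟩ := D.exists_bound_energy_closedBall x₀
  set R := max (D.apriori E₁ M t) 1 with hRdef
  have hR : 0 < R := lt_max_of_lt_right one_pos
  obtain ⟨L, hL⟩ := D.exists_lipschitzWith_trunc hR
  have heq : ∀ x ∈ closedBall x₀ 1, drivenFlow Y x n t = drivenTruncSol Y R x n t := fun x hx =>
    D.flow_eqOn_truncSol hR x hn hnS hM ((D.apriori_mono M t (hE₁ x hx)).trans (le_max_left _ _))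
      ⟨ht.le, le_rfl⟩
  have hev : (fun x => drivenFlow Y x n t) =ᶠ[𝓝 x₀] fun x => drivenTruncSol Y R x n t :=
    Filter.eventuallyEq_of_mem (closedBall_mem_nhds x₀ one_pos) heq
  refine ContinuousAt.congr_of_eventuallyEq ?_ hev
  have hlip : ∀ x x' : E, ‖drivenTruncSol Y R x n t - drivenTruncSol Y R x' n t‖ ≤
      ‖x - x'‖ * Real.exp (L * t) := fun x x' =>
    norm_forcedSolution_sub_le hL (continuous_const.add hn) (continuous_const.add hn)
      (g₁ := fun t => x + n t) (g₂ := fun t => x' + n t) (fun r _ => by simp) t ⟨ht.le, le_rfl⟩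
  rw [Metric.continuousAt_iff]
  intro ε hε
  refine ⟨ε / Real.exp (L * t), by positivity, fun x hx => ?_⟩
  rw [dist_eq_norm] at hx ⊢
  calc ‖drivenTruncSol Y R x n t - drivenTruncSol Y R x₀ n t‖ ≤ ‖x - x₀‖ * Real.exp (L * t) :=
        hlip x x₀
    _ < ε / Real.exp (L * t) * Real.exp (L * t) := by gcongr
    _ = ε := div_mul_cancel₀ ε (Real.exp_pos _).ne'

/-! ### Measurable dependence on parameters -/

/-- **The flow depends measurably on a measurably parametrised initial condition and noise path**
(each truncated solution does, by `stronglyMeasurable_forcedSolution`, and the flow is their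
pointwise — eventually constant — limit). [folklore] -/
theorem measurable_flow [MeasurableSpace E] [BorelSpace E] {Ω : Type*} {mΩ : MeasurableSpace Ω}
    {X : Ω → E} (hX : Measurable X) {G : Ω → ℝ → E} (hGc : ∀ w, Continuous (G w))
    (hGS : ∀ w t, G w t ∈ D.noise) (hGm : ∀ t, Measurable fun w => G w t) (t : ℝ) :
    Measurable fun w => drivenFlow Y (X w) (G w) t := by
  have hk : ∀ k : ℕ, Measurable fun w => drivenTruncSol Y (k + 1) (X w) (G w) t := by
    intro k
    obtain ⟨L, hL⟩ := D.exists_lipschitzWith_trunc (by positivity : (0 : ℝ) < k + 1)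
    have h := stronglyMeasurable_forcedSolution (mΩ := mΩ) (G := fun w => fun r => X w + G w r) hL
      (fun w => continuous_const.add (hGc w)) (fun r => ?_) t
    · exact h.measurable
    · exact (hX.add (hGm r)).stronglyMeasurable
  refine measurable_of_tendsto_metrizable hk ?_
  rw [tendsto_pi_nhds]
  intro w
  rcases le_or_gt t 0 with ht | ht
  · have hc : ∀ k : ℕ, drivenTruncSol Y (k + 1) (X w) (G w) t = X w + G w 0 := by
      intro k
      obtain ⟨L, hL⟩ := D.exists_lipschitzWith_trunc (by positivity : (0 : ℝ) < k + 1)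
      have hg : Continuous fun r => X w + G w r := continuous_const.add (hGc w)
      unfold drivenTruncSol
      rw [forcedSolution_of_nonpos _ _ ht, forcedSolution_zero hL hg]
    rw [D.flow_of_nonpos (X w) (hGc w) ht]
    simp only [hc]
    exact tendsto_const_nhds
  · obtain ⟨M, -, hM⟩ := exists_forcingBound (hGc w) t
    set R := D.apriori (D.V (X w)) M t
    obtain ⟨k₀, hk₀⟩ := exists_nat_ge R
    refine tendsto_const_nhds.congr' ?_
    filter_upwards [eventually_ge_atTop k₀] with k hk
    have hkR : R ≤ (k : ℝ) + 1 := hk₀.trans (by exact_mod_cast Nat.le_succ_of_le hk)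
    exact D.flow_eqOn_truncSol (by positivity) (X w) (hGc w) (hGS w) hM hkR ⟨ht.le, le_rfl⟩

end ConfinedDrift

end Literature.MathematicalPhysics.KineticTheory
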